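import Summits.BirchSwinnertonDyer.BirchSwinnertonDyer.Theorems.GenusKolyvaginAtTwoOffCutResidualAtTwoRVisibleDeepSocleDoorTrivialLine
import Summits.BirchSwinnertonDyer.BirchSwinnertonDyer.Theorems.GenusKolyvaginAtTwoOffCutResidualAtTwoRSocleSelectionHeegnerSocleSOC
import Summits.BirchSwinnertonDyer.BirchSwinnertonDyer.Theorems.GenusKolyvaginAtTwoGenusPrimitiveSupplyAtTwoHeegnerTwinParity
import Literature.NumberTheory.EllipticCurves.HeegnerHypothesisKroneckerProofs
import Literature.NumberTheory.QuadraticFields.KroneckerSplitting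
import HarnessLib

/-!
# Route `GenusKolyvaginAtTwo`, residual `OffCutResidualAtTwoR` (stmt-BirchSwinnertonDyer-31767), LINE 28 «visible_deep_socle» STUB N2 —
# the (SOC) and (LTV) conjuncts of `stub_deepFrameSocle` ON N2's OWN BINDERS (no extra hypothesis), and the frame supplier
# «deep prime frame ⟹ transposition-admissible»

LEAD seat `bsd-line-gk2-p1` g25 (cell `bsd-f1-sign2`), `--supports stmt-BirchSwinnertonDyer-31767 --as helper`; sequel of `…VisibleDeepSocleDoorTrivialLine`
(the `ℓ₀`-trivial line of `Sel₂(E)` is the twin's Selmer group) and of LINE 27's `…HeegnerSocleSOC` / `…HeegnerSocleUnramSOC` (the real place `∞` replaced by the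
door place `v ∋ ℓ₀`).  THEOREMS ONLY (no definition, no named fact, no `sorry`).  **BSD is NOT proved by this file; `OffCutResidualAtTwoR`, K4Neg and crux 23491
are NOT proved; N2 is NOT closed — its (HL) conjunct (visibility of the Heegner socle under the frame's `ℓ₀`-VIS hypothesis) remains.**

* §0 **`transpAdmissible_of_deepPrimeFrame`** — THE FRAME SUPPLIER: for `Δ_E < 0`, an imaginary quadratic `K = ℚ(√-ℓ₀)` (`ℓ₀` prime, `d_K = -ℓ₀` odd) with the
  Heegner hypothesis for `N_E` and `2` SPLIT is transposition-admissible at `ℓ₀`: `d_K ≡ 1 (8)` (decomposition law at `2`), `(Δ/ℓ₀) = -1` because the number of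
  transposition primes of `d_K` is ODD at `Δ < 0` (gk2-p5's `exists_prime_dvd_discr_jacobiSym_eq_neg_one_of_Δ_neg`) and `ℓ₀` is the only prime of `d_K`, `ℓ₀ ∤ N_E`
  (split primes are unramified), the odd bad primes split (`(d_K/p) = 1`).  No Tamagawa budget and no Selmer count is used.
* §2 **`sharedSocle_of_doorTrivialSocle`** — N2's (SOC) conjunct with N2's binders VERBATIM: for `M ≥ M₀ + 1` and `s₀ ∈ Sel_(2^M)(E/ℚ)` whose socle is the
  level-raise of a non-zero `ℓ₀`-TRIVIAL class `c`, the lines `⟨ι res_K s₀⟩` and `⟨ι c_M(1)⟩` share their socle one level up (both are `ι_{1→M+1} κ₂(y_K/2^{M₀}) ≠ 0`):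
  `c ∈ Sel₂(E)` (level-stability) is `ℓ₀`-trivial, hence lies in `T = Sel_𝔓(A_χ)` (`doorTrivial_iff_mem_primeTwist_selmerGroup`), hence CAPITULATES to `κ₂(Q₀)`
  over `K` (rank-one dichotomy, ranks `0 + 1` by PRINT `MultPublishedInputsAtTwo`), and the Heegner socle is `ι κ₂(Q₀)` (`pow_zsmul_kolyvaginClass_one_eq_torsionH1OfDvd_kummer`).
  **`exists_doorTrivial_ne_zero_of_deepPrimeFrame`** — N2's (LTV) conjunct with N2's binders VERBATIM; **`deepFrameSocle_soc_and_ltv`** — both at once.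
  The `ℓ₀`-VIS hypothesis and the twin budget `ord₂ c(Wd) ≤ 1` of N2 are carried and NOT used by (SOC)/(LTV).
BSD is NOT proved by any of this.

References: [MazurRubin2010] Lemma 2.2, Prop. 3.3; [Kramer1981] Prop. 3, Thm. 1; [GrossLMS1991] §4–§5; [McCallumLMS1991] §4–§5; [MazurRubin2007] §3–§4.
-/

set_option autoImplicit false
-- the Theorems namespace of this sub repeats the summit name by design (D-0017 nested layout)
set_option linter.dupNamespace false

noncomputable section

open scoped Classical

namespace Summit.BirchSwinnertonDyer.BirchSwinnertonDyer.Theorems.GenusExact.PlusDescent.SocleSelection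

open WeierstrassCurve NumberField IsDedekindDomain Field
open Literature.NumberTheory.EllipticCurves Literature.NumberTheory.GaloisRepresentations
open Summit.BirchSwinnertonDyer.Rank1Residual.F1Sign2 (NoRationalTwoTorsion IsQuadraticCharacterOf)
open Summit.BirchSwinnertonDyer.Rank1Residual.F1Sign2.TranspositionDoor (TranspAdmissible)
open Summit.BirchSwinnertonDyer.BirchSwinnertonDyer.Theorems.GenusKolyArch
open Summit.BirchSwinnertonDyer.BirchSwinnertonDyer.Theorems.GenusSupplyNarrow.KFourPosCell
open Summit.BirchSwinnertonDyer.BirchSwinnertonDyer.Theses.GenusKolyvaginAtTwo (MultPublishedInputsAtTwo)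
open Literature.NumberTheory.EllipticCurves.ModularForms Literature.NumberTheory.EllipticCurves.KolyvaginCocycle

universe u

/-! ## §0 The frame supplier: a deep prime frame is transposition-admissible -/

/-- **A DEEP PRIME FRAME IS TRANSPOSITION-ADMISSIBLE.**  `Δ_E < 0`, `K` imaginary quadratic with `d_K = -ℓ₀` odd (`ℓ₀` prime), the Heegner hypothesis for
`N_E` and `2` split in `K`: then `(d_K, ℓ₀)` is transposition-admissible — `d_K < 0` squarefree, `d_K ≡ 1 (8)`, `ℓ₀ ∤ N_E` of good reduction with
`(Δ/ℓ₀) = -1` (the unique prime of `d_K` is the transposition prime that `Δ < 0` forces), every odd bad prime split.  BSD is NOT proved by this.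
[cite: MazurRubin2010, Prop. 3.3] [cite: Kramer1981, Prop. 3] [cite: GrossLMS1991, §3 (3.4)] -/
theorem transpAdmissible_of_deepPrimeFrame (W : WeierstrassCurve ℚ) [W.IsElliptic] [W.IsGloballyMinimal]
    {K : Type} [Field K] [NumberField K] (hIQ : IsImaginaryQuadratic K) (hodd : Odd (discr K))
    (hHe : SatisfiesHeegnerHypothesis (W.conductorNorm ℤ) K) (hΔ : W.Δ < 0) {ℓ₀ : ℕ} (hℓ₀ : ℓ₀.Prime)
    (hdK : discr K = -(ℓ₀ : ℤ)) (h2K : ((Ideal.span {(2 : ℤ)}).primesOver (𝓞 K)).ncard = 2) :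
    TranspAdmissible W (discr K) ℓ₀ := by
  have h2 : Module.finrank ℚ K = 2 := hIQ.1
  have hℓ₀N : ¬ ℓ₀ ∣ W.conductorNorm ℤ := fun h ↦
    Literature.SatisfiesHeegnerHypothesis.not_dvd_discr h2 hHe hℓ₀ h (by rw [hdK]; exact dvd_neg.mpr dvd_rfl)
  -- `(Δ/ℓ₀) = -1`: the unique prime of `d_K = -ℓ₀` is a transposition prime (`Δ < 0`)
  have hjac : jacobiSym W.Δ.num ℓ₀ = -1 := by
    obtain ⟨q, hq, -, hqd, -, -, hJ⟩ := GenusKolyTwin.exists_prime_dvd_discr_jacobiSym_eq_neg_one_of_Δ_neg W hIQ hodd hHe hΔ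
    rw [hdK, dvd_neg, Int.natCast_dvd_natCast, Nat.prime_dvd_prime_iff_eq hq hℓ₀] at hqd
    subst hqd
    rwa [← cast_minimalDiscriminantInt W, Rat.num_intCast]
  refine ⟨?_, ?_, ?_, hℓ₀, ?_, hjac, fun q hq hqd ↦ ?_, fun p hp hp2 hbad ↦ ?_⟩
  · rw [hdK, neg_lt_zero]; exact_mod_cast hℓ₀.pos
  · rw [hdK, ← Int.squarefree_natAbs, Int.natAbs_neg, Int.natAbs_natCast]
    exact hℓ₀.squarefree
  · exact (Literature.NumberTheory.QuadraticFields.Quadratic.ncard_primesOver_two_eq_two_iff h2).mp h2K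
  · rw [hdK]; exact dvd_neg.mpr dvd_rfl
  · rw [hdK, dvd_neg, Int.natCast_dvd_natCast, Nat.prime_dvd_prime_iff_eq hq hℓ₀] at hqd
    subst hqd
    refine ⟨fun _ ↦ ?_, fun h ↦ absurd rfl h⟩
    by_contra hng
    exact hℓ₀N ((W.dvd_conductorNorm_iff_not_hasGoodReductionAtPrime q).mpr hng)
  · haveI := Fact.mk hp
    have hpN : p ∣ W.conductorNorm ℤ := (W.dvd_conductorNorm_iff_not_hasGoodReductionAtPrime p).mpr (hbad inferInstance)
    exact Literature.SatisfiesHeegnerHypothesis.jacobiSym_discr_eq_one h2 hHe hp hpN hp2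

/-! ## §1 Socle algebra (private) -/

section SOC
/-- `E(K)[2] = 0` (in `(2 : ℤ) •` form) for `ρ̄_{E,2}` onto and `K` imaginary quadratic. [cite: DokchitserDokchitserMathZ2012, Theorem (1)] -/
private theorem two_zsmul_eq_zero_imp (W : WeierstrassCurve ℚ) [W.IsElliptic] {K : Type} [Field K] [NumberField K]
    (hρ : W.HasSurjectiveModNGaloisRep 2) (hK : IsImaginaryQuadratic K) (T : (W.baseChange K).toAffine.Point) (hT2 : (2 : ℤ) • T = 0) :
    T = 0 := by
  have hmem : T ∈ AddSubgroup.torsionBy (W.baseChange K).toAffine.Point (2 : ℤ) := (Submodule.mem_torsionBy_iff _ T).mpr hT2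
  rw [torsionBy_two_baseChange_eq_bot_of_hasSurjectiveModNGaloisRep_two_of_isImaginaryQuadratic W hρ K hK] at hmem
  exact AddSubgroup.mem_bot.mp hmem

/-- Socle uniqueness in a cyclic `2`-group: if `2^k • w` has order exactly `2` (`w` of `2`-power order), every `m • w` killed by `2` is `0`
or `2^k • w`.  (Adapted from the LINE 27 skeleton's `zsmul_eq_zero_or_eq_socle`, bsd-idea-1 g25, kernel-checked there.) [folklore] -/
private theorem zsmul_eq_zero_or_eq_socle {A : Type*} [AddCommGroup A] {n : ℕ} (w : A)
    (hw : ((2 ^ n : ℕ) : ℤ) • w = 0) (k : ℕ) (hne : ((2 ^ k : ℕ) : ℤ) • w ≠ 0)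
    (h2 : (2 : ℤ) • (((2 ^ k : ℕ) : ℤ) • w) = 0) (m : ℤ) (hm : (2 : ℤ) • (m • w) = 0) :
    m • w = 0 ∨ m • w = ((2 ^ k : ℕ) : ℤ) • w := by
  have ho : addOrderOf w ∣ 2 ^ n := by
    rw [natCast_zsmul] at hw
    exact addOrderOf_dvd_iff_nsmul_eq_zero.2 hw
  have hk : ¬ addOrderOf w ∣ 2 ^ k := by
    intro h
    apply hne
    rw [natCast_zsmul]
    exact addOrderOf_dvd_iff_nsmul_eq_zero.1 h
  have hk1 : addOrderOf w ∣ 2 ^ (k + 1) := by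
    apply addOrderOf_dvd_iff_nsmul_eq_zero.2
    have h2' : (2 : ℕ) • (((2 ^ k : ℕ) : ℤ) • w) = 0 := by
      rw [two_nsmul]; rw [two_zsmul] at h2; exact h2
    rw [natCast_zsmul] at h2'
    rw [pow_succ', mul_smul]
    exact h2'
  obtain ⟨e, -, hoe⟩ := (Nat.dvd_prime_pow Nat.prime_two).1 ho
  rw [hoe] at hk hk1
  have he1 : e ≤ k + 1 := (Nat.pow_dvd_pow_iff_le_right (by norm_num)).1 hk1
  have he2 : ¬ e ≤ k := fun h ↦ hk ((Nat.pow_dvd_pow_iff_le_right (by norm_num)).2 h)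
  have he : e = k + 1 := by omega
  have hdvd : ((addOrderOf w : ℕ) : ℤ) ∣ 2 * m := by
    apply addOrderOf_dvd_iff_zsmul_eq_zero.2
    rw [mul_smul]; exact hm
  rw [hoe, he] at hdvd
  push_cast at hdvd
  rw [pow_succ'] at hdvd
  obtain ⟨m', rfl⟩ := (mul_dvd_mul_iff_left (two_ne_zero : (2 : ℤ) ≠ 0)).1 hdvd
  have hσ : ((2 ^ k : ℕ) : ℤ) • w + ((2 ^ k : ℕ) : ℤ) • w = 0 := by
    rw [← two_zsmul]; exact h2
  have hmw : (2 ^ k * m') • w = m' • (((2 ^ k : ℕ) : ℤ) • w) := by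
    push_cast
    rw [mul_comm, mul_smul]
  rw [hmw]
  rcases Int.even_or_odd m' with ⟨r, hr⟩ | ⟨r, hr⟩
  · left
    rw [hr, add_smul, ← smul_add, hσ, smul_zero]
  · right
    rw [hr, add_smul, one_smul, mul_smul, two_zsmul, ← smul_add, hσ, smul_zero, zero_add]

/-- In a `2`-power-torsion group, an integer multiple `k • x` of order exactly `2` is a POWER-OF-`2` multiple `2^i • x`. [folklore] -/
private theorem exists_pow_zsmul_eq_of_zsmul_eq {A : Type*} [AddCommGroup A] {n : ℕ} (x : A)
    (hx : ((2 ^ n : ℕ) : ℤ) • x = 0) (k : ℤ) (hσ : k • x ≠ 0) (h2 : (2 : ℤ) • (k • x) = 0) :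
    ∃ i : ℕ, ((2 ^ i : ℕ) : ℤ) • x = k • x := by
  -- the additive order of `x` is `2^e`, `e ≥ 1`
  have ho : addOrderOf x ∣ 2 ^ n := by
    rw [natCast_zsmul] at hx
    exact addOrderOf_dvd_iff_nsmul_eq_zero.2 hx
  obtain ⟨e, -, hoe⟩ := (Nat.dvd_prime_pow Nat.prime_two).1 ho
  have hx0 : x ≠ 0 := by rintro rfl; exact hσ (smul_zero k)
  have he : e ≠ 0 := by
    rintro rfl
    rw [pow_zero, AddMonoid.addOrderOf_eq_one_iff] at hoe
    exact hx0 hoe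
  obtain ⟨f, rfl⟩ : ∃ f, e = f + 1 := ⟨e - 1, by omega⟩
  refine ⟨f, ?_⟩
  have hne : ((2 ^ f : ℕ) : ℤ) • x ≠ 0 := by
    intro h
    rw [natCast_zsmul] at h
    have hd := addOrderOf_dvd_iff_nsmul_eq_zero.2 h
    rw [hoe, Nat.pow_dvd_pow_iff_le_right (by norm_num)] at hd
    omega
  have h2f : (2 : ℤ) • (((2 ^ f : ℕ) : ℤ) • x) = 0 := by
    rw [smul_smul, show (2 : ℤ) * ((2 ^ f : ℕ) : ℤ) = ((2 ^ (f + 1) : ℕ) : ℤ) by push_cast; ring, ← hoe, natCast_zsmul,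
      addOrderOf_nsmul_eq_zero]
  rcases zsmul_eq_zero_or_eq_socle x hx f hne h2f k h2 with h | h
  · exact absurd h hσ
  · exact h.symm

/-- `ι ∘ ι = ι` for the change-of-level maps `torsionH1OfDvd` (functoriality in compatible pairs). [cite: SerreGaloisCohomology1997, I.§2.4] -/
private theorem torsionH1OfDvd_torsionH1OfDvd {K₀ : Type u} [Field K₀] (V : WeierstrassCurve K₀) {d m n : ℤ}
    (h₁ : d ∣ m) (h₂ : m ∣ n) (x : galH1Torsion V d) :
    torsionH1OfDvd V h₂ (torsionH1OfDvd V h₁ x) = torsionH1OfDvd V (h₁.trans h₂) x := by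
  unfold torsionH1OfDvd
  rw [resH1Hom_resH1Hom]
  exact congrFun (congrArg DFunLike.coe (resH1Hom_congr (by ext; rfl) (by ext; rfl) _ _)) x

/-! ## §2 N2's (SOC) and (LTV) on N2's own binders -/

/-- **LINE 28 N2, conjunct (SOC) — on N2's binders VERBATIM** (the `ℓ₀`-VIS hypothesis and the twin budget are carried, unused).  For `M ≥ M₀ + 1` and
`s₀ ∈ Sel_(2^M)(E/ℚ)` whose socle is (the level-raise of) a non-zero `ℓ₀`-TRIVIAL class `c`, the lines `⟨ι res_K s₀⟩` and `⟨ι c_M(1)⟩` SHARE THEIR SOCLE one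
level up: both socles are `ι_{1→M+1} κ₂(y_K/2^{M₀}) ≠ 0`.  Proof: §0 makes the frame transposition-admissible; `c ∈ Sel₂(E)` (level-stability) is `ℓ₀`-trivial,
so `c ∈ Sel_𝔓(A_χ)` (`doorTrivial_iff_mem_primeTwist_selmerGroup`), so `res_K c = κ₂(Q₀)` (capitulation + rank-one dichotomy, ranks `0 + 1` by PRINT
`MultPublishedInputsAtTwo`); the Heegner socle is `ι κ₂(Q₀)` (`pow_zsmul_kolyvaginClass_one_eq_torsionH1OfDvd_kummer`).  BSD is NOT proved by this; N2's (HL)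
conjunct remains. [cite: MazurRubin2010, Lemma 2.2, Prop. 3.3] [cite: Kramer1981, Thm. 1] [cite: GrossLMS1991, §4 (4.4), §5 (5.1)]
[cite: McCallumLMS1991, §4 Lemma 4.6, §5 Lemma 5.1] [cite: MazurRubin2007, §3, Prop 4.1, Def 4.3] -/
theorem sharedSocle_of_doorTrivialSocle :
    ∀ (W : WeierstrassCurve ℚ) [W.IsElliptic] [W.IsGloballyMinimal] [NeZero (W.conductorNorm ℤ)],
      W.analyticRank = 0 → (∀ n : ℕ, 0 < n → W.HasSurjectiveModNGaloisRep ((2 : ℤ) ^ n)) → Odd W.tamagawaProduct → W.Δ < 0 →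
      ∀ (K : Type) [Field K] [NumberField K], IsImaginaryQuadratic K → Odd (NumberField.discr K) → NumberField.discr K ≠ -3 →
        SatisfiesHeegnerHypothesis (W.conductorNorm ℤ) K →
        ¬ IsSquare ((NumberField.discr K : ℚ) * -|W.Δ|) → ¬ IsSquare ((NumberField.discr K : ℚ) * (-(2 * |W.Δ|))) →
      ∀ (ℓ₀ : ℕ) (v : HeightOneSpectrum (𝓞 ℚ)), ℓ₀.Prime → NumberField.discr K = -(ℓ₀ : ℤ) →
        ((Ideal.span {(2 : ℤ)}).primesOver (𝓞 K)).ncard = 2 → ((ℓ₀ : ℕ) : 𝓞 ℚ) ∈ v.asIdeal →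
        (∀ c : galH1Torsion W 2, c ∈ W.selmerGroup 2 → c ∈ W.torsionLocalKer (v.adicCompletion ℚ) 2 →
            (∀ (h₁₂ : (2 : ℤ) ∣ ((2 ^ 2 : ℕ) : ℤ)), ∀ ρ ∈ torsionFixing W ((2 ^ 2 : ℕ) : ℤ),
              h1Eval W ((2 ^ 2 : ℕ) : ℤ) (torsionH1OfDvd W h₁₂ c) ρ = 0) → c = 0) →
      ∀ (Dt : ModularParametrizationData W (W.conductorNorm ℤ)),
        (∀ z ∈ Dt.L.lattice, ∃ w ∈ periodLattice Dt.f, z = (Dt.c : ℂ) * w) → Odd Dt.c →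
      ∀ (β : ℤ) (ι : K →+* ℂ) (d₁ : KolyvaginHeegnerData Dt β ι 1), ¬ IsOfFinAddOrder d₁.derivedPoint →
      ∀ (M₀ : ℕ), (∃ Q : (W.baseChange (ringClassField K ι 1)).toAffine.Point, ((2 ^ M₀ : ℕ) : ℤ) • Q = d₁.derivedPoint) →
        (¬ ∃ Q : (W.baseChange (ringClassField K ι 1)).toAffine.Point, ((2 ^ (M₀ + 1) : ℕ) : ℤ) • Q = d₁.derivedPoint) →
      ∀ (Wd : WeierstrassCurve ℚ) [Wd.IsElliptic] [Wd.IsGloballyMinimal],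
        (∃ C : WeierstrassCurve.VariableChange ℚ, C • W.quadraticTwist (NumberField.discr K : ℚ) = Wd) →
        Wd.analyticRank = 1 → Nat.card (Wd.selmerGroup 2) = 2 → padicValNat 2 Wd.tamagawaProduct ≤ 1 →
      Nat.card (W.selmerGroup 2) = 4 → MultPublishedInputsAtTwo →
      (∀ (M : ℕ), M₀ + 1 ≤ M → ∀ (s₀ : galH1Torsion W ((2 ^ M : ℕ) : ℤ)), s₀ ∈ selmerGroup W ((2 ^ M : ℕ) : ℤ) →
          (∃ c : galH1Torsion W 2, c ≠ 0 ∧ c ∈ W.torsionLocalKer (v.adicCompletion ℚ) 2 ∧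
            ∀ hdvd₁ : (2 : ℤ) ∣ ((2 ^ M : ℕ) : ℤ), torsionH1OfDvd W hdvd₁ c ∈ AddSubgroup.zmultiples s₀) →
          ∀ (hdvd : ((2 ^ M : ℕ) : ℤ) ∣ ((2 ^ (M + 1) : ℕ) : ℤ)), ∃ i j : ℕ,
            ((2 ^ i : ℕ) : ℤ) • torsionH1OfDvd (W.baseChange K) hdvd (resTorsion W K ((2 ^ M : ℕ) : ℤ) s₀) =
              ((2 ^ j : ℕ) : ℤ) • torsionH1OfDvd (W.baseChange K) hdvd (d₁.kolyvaginClass Nat.prime_two M) ∧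
            ((2 ^ j : ℕ) : ℤ) • torsionH1OfDvd (W.baseChange K) hdvd (d₁.kolyvaginClass Nat.prime_two M) ≠ 0 ∧
            (2 : ℤ) • (((2 ^ j : ℕ) : ℤ) • torsionH1OfDvd (W.baseChange K) hdvd (d₁.kolyvaginClass Nat.prime_two M)) = 0) := by
  intro W _ _ _ hr0 hρ _hTam hneg K _ _ hIQ hodd _h3 hHe hsq1 _hsq2 ℓ₀ v hℓ₀ hdK h2K hv _hVIS Dt _hopt _hc β ι d₁ _hy M₀ hdiv hndiv Wd _ _ hWd hrd hSel
    _hbudget h4 hGZK M hM s₀ hs₀ hsoc hdvd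
  obtain ⟨c, hc0, hcv, hcz⟩ := hsoc
  haveI : (W.baseChange K).IsElliptic := inferInstanceAs (W.map (algebraMap ℚ K)).IsElliptic
  have h2 : Module.finrank ℚ K = 2 := hIQ.1
  obtain ⟨θ, hθ, hθc⟩ := exists_sq_eq_discr_not_mem_range K h2
  have hsurj1 : W.HasSurjectiveModNGaloisRep ((2 : ℤ) ^ 1) := hρ 1 one_pos
  have hρ2 : W.HasSurjectiveModNGaloisRep 2 := by simpa using hsurj1
  have hT : NoRationalTwoTorsion W := GenusKolyTwin.noRationalTwoTorsion_of_hasSurjectiveModNGaloisRep W hsurj1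
  obtain ⟨Cd, hCd⟩ := hWd
  obtain ⟨χ, hχ⟩ := GenusKolyTransp.quadraticCharacterExists_holds (discr K)
  -- ranks from print: `rank E(ℚ) = 0`, `rank Wd(ℚ) = 1`, hence `rank E(K) = 1`
  have hrkW : W.mordellWeilRank = 0 := by rw [(hGZK W (by rw [hr0]; exact zero_le_one)).1, hr0]
  have hrkWd : Wd.mordellWeilRank = 1 := by rw [(hGZK Wd (by rw [hrd])).1, hrd]
  have hrkTw : (W.quadraticTwist (discr K : ℚ)).mordellWeilRank = 1 := by
    rw [← mordellWeilRank_variableChange_holds (W.quadraticTwist (discr K : ℚ)) Cd, hCd, hrkWd]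
  have hrkK : (W.baseChange K).mordellWeilRank = 1 := by
    rw [mordellWeilRank_baseChange_eq_add_of_sq_eq W K h2 hθ hθc, hrkW, hrkTw]
  -- `E(K)[2] = 0`
  have hbotK : AddSubgroup.torsionBy (W.baseChange K).toAffine.Point (2 : ℤ) = ⊥ :=
    torsionBy_two_baseChange_eq_bot_of_hasSurjectiveModNGaloisRep_two_of_isImaginaryQuadratic W hρ2 K hIQ
  have h2Kt := two_zsmul_eq_zero_imp W hρ2 hIQ
  -- the frame is transposition-admissible at `ℓ₀` (§0); then `P₀ ∈ E(K)` under `P(1)`, `Q₀ = P₀/2^{M₀} ∉ 2E(K)` (McCallum 5.1)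
  have hadm : TranspAdmissible W (discr K) ℓ₀ := transpAdmissible_of_deepPrimeFrame W hIQ hodd hHe hneg hℓ₀ hdK h2K
  have hsqΔ : ¬ IsSquare ((NumberField.discr K : ℚ) * W.Δ) := by
    rwa [show -|W.Δ| = W.Δ by rw [abs_of_neg hneg, neg_neg]] at hsq1
  have htors1 : ∀ T : (W.baseChange (ringClassField K ι 1)).toAffine.Point, (2 : ℤ) • T = 0 → T = 0 := by
    intro T hT
    have h := GenusExact.torsionBy_two_ringClassField_eq_bot W hIQ ι one_ne_zero hρ2 hsqΔ
    have hT' : T ∈ AddSubgroup.torsionBy (W.baseChange (ringClassField K ι 1)).toAffine.Point ((2 : ℕ) : ℤ) :=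
      (Submodule.mem_torsionBy_iff _ T).mpr (by exact_mod_cast hT)
    rw [h] at hT'
    exact (AddSubgroup.mem_bot).mp hT'
  obtain ⟨P₀, -, hP₀⟩ := heegnerSystem_exists_isHeegnerPoint_map_eq_derivedPoint_one
    (heegnerPointOfConductor_one_galoisConj_holds (W.conductorNorm ℤ) W K) hIQ hHe d₁
  have hdivK : ∃ Q₀ : (W.baseChange K).toAffine.Point, ((2 ^ M₀ : ℕ) : ℤ) • Q₀ = P₀ := by
    obtain ⟨Q, hQ⟩ := hdiv
    obtain ⟨Q₀, hQ₀⟩ := (McCallum1991.exists_pow_smul_eq_derivedPoint_one_iff hIQ d₁ (p := 2) htors1 hP₀ M₀).mp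
      ⟨Q, by simpa only [Nat.cast_pow, Nat.cast_ofNat] using hQ⟩
    exact ⟨Q₀, by simpa only [Nat.cast_pow, Nat.cast_ofNat] using hQ₀⟩
  have hndivK : ¬ ∃ Q₁ : (W.baseChange K).toAffine.Point, ((2 ^ (M₀ + 1) : ℕ) : ℤ) • Q₁ = P₀ := by
    rintro ⟨Q₁, hQ₁⟩
    refine hndiv ?_
    obtain ⟨Q, hQ⟩ := (McCallum1991.exists_pow_smul_eq_derivedPoint_one_iff hIQ d₁ (p := 2) htors1 hP₀ (M₀ + 1)).mpr
      ⟨Q₁, by simpa only [Nat.cast_pow, Nat.cast_ofNat] using hQ₁⟩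
    exact ⟨Q, by simpa only [Nat.cast_pow, Nat.cast_ofNat] using hQ⟩
  obtain ⟨Q₀, hQ₀⟩ := hdivK
  have hQ₀nd : ¬ ∃ R : (W.baseChange K).toAffine.Point, (2 : ℤ) • R = Q₀ := by
    rintro ⟨R, hR⟩
    refine hndivK ⟨R, ?_⟩
    have h22 : ((2 ^ (M₀ + 1) : ℕ) : ℤ) = ((2 ^ M₀ : ℕ) : ℤ) * 2 := by push_cast; ring
    rw [h22, mul_smul, hR, hQ₀]
  -- Step 1: `c ∈ Sel₂(E)` (level-stability of the local kernels; `ι c ∈ ℤ s₀ ⊆ Sel_(2^M)`)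
  have hM1 : 1 ≤ M := by omega
  have hdvd₁ : (2 : ℤ) ∣ ((2 ^ M : ℕ) : ℤ) := by
    rw [show M = (M - 1) + 1 by omega, pow_succ]; push_cast; exact Dvd.intro_left _ rfl
  obtain ⟨k, hk⟩ := AddSubgroup.mem_zmultiples_iff.mp (hcz hdvd₁)
  have hιc : torsionH1OfDvd W hdvd₁ c ∈ selmerGroup W ((2 ^ M : ℕ) : ℤ) := by
    rw [← hk]; exact AddSubgroup.zsmul_mem _ hs₀ k
  have hcSel : c ∈ W.selmerGroup ((2 : ℕ) : ℤ) := by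
    rw [mem_selmerGroup_iff] at hιc ⊢
    exact ⟨fun v ↦ (GenusExact.VisiblePairAtTwo.torsionH1OfDvd_mem_selmerLocalKer_iff W _ hdvd₁ c).mpr (hιc.1 v),
      fun w ↦ (GenusExact.VisiblePairAtTwo.torsionH1OfDvd_mem_selmerLocalKer_iff W _ hdvd₁ c).mpr (hιc.2 w)⟩
  -- Step 2: `c` is in the twin's Selmer group, hence capitulates: `res_K c = κ₂(Q₀)`
  have hcT : c ∈ PrimeTwist.selmerGroup W χ :=
    (doorTrivial_iff_mem_primeTwist_selmerGroup W hneg h4 hadm hv Cd hCd hSel hχ c).mp ⟨hcSel, hcv⟩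
  obtain ⟨Q', hQ'⟩ := resTorsion_mem_range_kummer_of_mem_primeTwist_selmerGroup W (K := K) hT (NumberField.discr_ne_zero K)
    ⟨θ, hθc⟩ Cd hCd hrkWd hSel hχ hcT
  have hresne : resTorsion W K ((2 : ℕ) : ℤ) c ≠ 0 := fun h0 ↦ hc0
    (GenusExact.EigenClassesFinite.resTorsion_injective_of_noTorsion W K h2 hθ hθc ((2 : ℕ) : ℤ) h2Kt (by rw [h0, map_zero]))
  have hresc : resTorsion W K ((2 : ℕ) : ℤ) c = kummerMapTorsion (W.baseChange K) ((2 : ℕ) : ℤ) (hdiv_two_baseChange W K) Q₀ := by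
    rcases kummerMapTorsion_eq_zero_or_eq_of_rank_one W K hrkK h2Kt hQ₀nd Q' with h0 | h1
    · exact absurd (hQ'.symm.trans h0) hresne
    · rw [← hQ', h1]
  have h1 : ((2 : ℕ) : ℤ) ∣ ((2 ^ (M + 1) : ℕ) : ℤ) := hdvd₁.trans hdvd
  set z : galH1Torsion (W.baseChange K) ((2 ^ (M + 1) : ℕ) : ℤ) :=
    torsionH1OfDvd (W.baseChange K) h1 (kummerMapTorsion (W.baseChange K) ((2 : ℕ) : ℤ) (hdiv_two_baseChange W K) Q₀) with hz
  have hheeg := pow_zsmul_kolyvaginClass_one_eq_torsionH1OfDvd_kummer W hIQ hodd hHe hsurj1 d₁ hP₀ hQ₀ hM hdvd h1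
  -- the Selmer side: `k • ι res s₀ = ι res (ι₁ c) = ι_{1→M+1} res c = z`
  have hsel : k • torsionH1OfDvd (W.baseChange K) hdvd (resTorsion W K ((2 ^ M : ℕ) : ℤ) s₀) = z := by
    rw [← map_zsmul, ← map_zsmul, hk, GenusExact.SelmerDescent.resTorsion_torsionH1OfDvd W K hdvd₁ c, torsionH1OfDvd_torsionH1OfDvd]
    -- the levels `2` and `((2 : ℕ) : ℤ)` agree definitionally
    change torsionH1OfDvd (W.baseChange K) h1 (resTorsion W K ((2 : ℕ) : ℤ) c) = z
    rw [hresc, hz]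
  -- `z ≠ 0` (`ι_{1→M+1}` injective over `K`, `res_K c ≠ 0`) and `2 • z = 0`
  have hz0 : z ≠ 0 := by
    intro h0
    have hbot' : AddSubgroup.torsionBy (W.baseChange K).toAffine.Point ((2 : ℕ) : ℤ) = ⊥ := hbotK
    have h1' : ((2 ^ 1 : ℕ) : ℤ) ∣ ((2 ^ (M + 1) : ℕ) : ℤ) := by simpa only [pow_one] using h1
    have hinj := GenusExact.VisiblePairAtTwo.torsionH1OfDvd_pow_injective (W.baseChange K) (p := 2) hbot' h1'
    apply hresne
    apply hinj
    rw [map_zero, hresc]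
    exact h0
  have hz2 : (2 : ℤ) • z = 0 := by
    rw [hz, ← map_zsmul, show (2 : ℤ) • kummerMapTorsion (W.baseChange K) ((2 : ℕ) : ℤ) (hdiv_two_baseChange W K) Q₀ = 0 from
      zsmul_galH1Torsion_eq_zero (W.baseChange K) _ _, map_zero]
  have hx2M : ((2 ^ (M + 1) : ℕ) : ℤ) • torsionH1OfDvd (W.baseChange K) hdvd (resTorsion W K ((2 ^ M : ℕ) : ℤ) s₀) = 0 :=
    zsmul_galH1Torsion_eq_zero (W.baseChange K) _ _
  obtain ⟨i, hi⟩ := exists_pow_zsmul_eq_of_zsmul_eq _ hx2M k (by rw [hsel]; exact hz0) (by rw [hsel]; exact hz2)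
  refine ⟨i, M - (M₀ + 1), ?_, ?_, ?_⟩
  · rw [hi, hsel, hheeg]
  · rw [hheeg]; exact hz0
  · rw [hheeg]; exact hz2

/-- **LINE 28 N2, conjunct (LTV) — on N2's binders VERBATIM**: a NON-ZERO `2`-Selmer class of `E` trivial at the door place `v ∋ ℓ₀` EXISTS (the `ℓ₀`-trivial
line has exactly two elements, `…DoorTrivialLine`; frame supplier §0).  BSD is NOT proved by this. [cite: MazurRubin2010, Lemma 2.2, Prop. 3.3] [cite: Kramer1981, Prop. 3] -/
theorem exists_doorTrivial_ne_zero_of_deepPrimeFrame :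
    ∀ (W : WeierstrassCurve ℚ) [W.IsElliptic] [W.IsGloballyMinimal] [NeZero (W.conductorNorm ℤ)],
      W.analyticRank = 0 → (∀ n : ℕ, 0 < n → W.HasSurjectiveModNGaloisRep ((2 : ℤ) ^ n)) → Odd W.tamagawaProduct → W.Δ < 0 →
      ∀ (K : Type) [Field K] [NumberField K], IsImaginaryQuadratic K → Odd (NumberField.discr K) → NumberField.discr K ≠ -3 →
        SatisfiesHeegnerHypothesis (W.conductorNorm ℤ) K →
        ¬ IsSquare ((NumberField.discr K : ℚ) * -|W.Δ|) → ¬ IsSquare ((NumberField.discr K : ℚ) * (-(2 * |W.Δ|))) →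
      ∀ (ℓ₀ : ℕ) (v : HeightOneSpectrum (𝓞 ℚ)), ℓ₀.Prime → NumberField.discr K = -(ℓ₀ : ℤ) →
        ((Ideal.span {(2 : ℤ)}).primesOver (𝓞 K)).ncard = 2 → ((ℓ₀ : ℕ) : 𝓞 ℚ) ∈ v.asIdeal →
        (∀ c : galH1Torsion W 2, c ∈ W.selmerGroup 2 → c ∈ W.torsionLocalKer (v.adicCompletion ℚ) 2 →
            (∀ (h₁₂ : (2 : ℤ) ∣ ((2 ^ 2 : ℕ) : ℤ)), ∀ ρ ∈ torsionFixing W ((2 ^ 2 : ℕ) : ℤ),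
              h1Eval W ((2 ^ 2 : ℕ) : ℤ) (torsionH1OfDvd W h₁₂ c) ρ = 0) → c = 0) →
      ∀ (Dt : ModularParametrizationData W (W.conductorNorm ℤ)),
        (∀ z ∈ Dt.L.lattice, ∃ w ∈ periodLattice Dt.f, z = (Dt.c : ℂ) * w) → Odd Dt.c →
      ∀ (β : ℤ) (ι : K →+* ℂ) (d₁ : KolyvaginHeegnerData Dt β ι 1), ¬ IsOfFinAddOrder d₁.derivedPoint →
      ∀ (M₀ : ℕ), (∃ Q : (W.baseChange (ringClassField K ι 1)).toAffine.Point, ((2 ^ M₀ : ℕ) : ℤ) • Q = d₁.derivedPoint) →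
        (¬ ∃ Q : (W.baseChange (ringClassField K ι 1)).toAffine.Point, ((2 ^ (M₀ + 1) : ℕ) : ℤ) • Q = d₁.derivedPoint) →
      ∀ (Wd : WeierstrassCurve ℚ) [Wd.IsElliptic] [Wd.IsGloballyMinimal],
        (∃ C : WeierstrassCurve.VariableChange ℚ, C • W.quadraticTwist (NumberField.discr K : ℚ) = Wd) →
        Wd.analyticRank = 1 → Nat.card (Wd.selmerGroup 2) = 2 → padicValNat 2 Wd.tamagawaProduct ≤ 1 →
      Nat.card (W.selmerGroup 2) = 4 → MultPublishedInputsAtTwo →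
      (∃ u ∈ W.selmerGroup 2, u ≠ 0 ∧ u ∈ W.torsionLocalKer (v.adicCompletion ℚ) 2) := by
  intro W _ _ _ _hr0 _hρ _hTam hneg K _ _ hIQ hodd _h3 hHe _hsq1 _hsq2 ℓ₀ v hℓ₀ hdK h2K hv _hVIS _Dt _hopt _hc _β _ι _d₁ _hy _M₀ _hdiv _hndiv Wd _ _
    hWd _hrd hSel _hbudget h4 _hGZK
  obtain ⟨Cd, hCd⟩ := hWd
  exact exists_doorTrivial_ne_zero W hneg h4 (transpAdmissible_of_deepPrimeFrame W hIQ hodd hHe hneg hℓ₀ hdK h2K) hv Cd hCd hSel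

/-- **LINE 28 N2, (SOC) ∧ (LTV) — on N2's binders VERBATIM** (the last two conjuncts of `stub_deepFrameSocle` as displayed there; only (HL) is left to the
line).  BSD is NOT proved by this. [cite: MazurRubin2010, Lemma 2.2, Prop. 3.3] [cite: GrossLMS1991, §4 (4.4), §5 (5.1)] [cite: McCallumLMS1991, §4 Lemma 4.6] -/
theorem deepFrameSocle_soc_and_ltv :
    ∀ (W : WeierstrassCurve ℚ) [W.IsElliptic] [W.IsGloballyMinimal] [NeZero (W.conductorNorm ℤ)],
      W.analyticRank = 0 → (∀ n : ℕ, 0 < n → W.HasSurjectiveModNGaloisRep ((2 : ℤ) ^ n)) → Odd W.tamagawaProduct → W.Δ < 0 →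
      ∀ (K : Type) [Field K] [NumberField K], IsImaginaryQuadratic K → Odd (NumberField.discr K) → NumberField.discr K ≠ -3 →
        SatisfiesHeegnerHypothesis (W.conductorNorm ℤ) K →
        ¬ IsSquare ((NumberField.discr K : ℚ) * -|W.Δ|) → ¬ IsSquare ((NumberField.discr K : ℚ) * (-(2 * |W.Δ|))) →
      ∀ (ℓ₀ : ℕ) (v : HeightOneSpectrum (𝓞 ℚ)), ℓ₀.Prime → NumberField.discr K = -(ℓ₀ : ℤ) →
        ((Ideal.span {(2 : ℤ)}).primesOver (𝓞 K)).ncard = 2 → ((ℓ₀ : ℕ) : 𝓞 ℚ) ∈ v.asIdeal →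
        (∀ c : galH1Torsion W 2, c ∈ W.selmerGroup 2 → c ∈ W.torsionLocalKer (v.adicCompletion ℚ) 2 →
            (∀ (h₁₂ : (2 : ℤ) ∣ ((2 ^ 2 : ℕ) : ℤ)), ∀ ρ ∈ torsionFixing W ((2 ^ 2 : ℕ) : ℤ),
              h1Eval W ((2 ^ 2 : ℕ) : ℤ) (torsionH1OfDvd W h₁₂ c) ρ = 0) → c = 0) →
      ∀ (Dt : ModularParametrizationData W (W.conductorNorm ℤ)),
        (∀ z ∈ Dt.L.lattice, ∃ w ∈ periodLattice Dt.f, z = (Dt.c : ℂ) * w) → Odd Dt.c →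
      ∀ (β : ℤ) (ι : K →+* ℂ) (d₁ : KolyvaginHeegnerData Dt β ι 1), ¬ IsOfFinAddOrder d₁.derivedPoint →
      ∀ (M₀ : ℕ), (∃ Q : (W.baseChange (ringClassField K ι 1)).toAffine.Point, ((2 ^ M₀ : ℕ) : ℤ) • Q = d₁.derivedPoint) →
        (¬ ∃ Q : (W.baseChange (ringClassField K ι 1)).toAffine.Point, ((2 ^ (M₀ + 1) : ℕ) : ℤ) • Q = d₁.derivedPoint) →
      ∀ (Wd : WeierstrassCurve ℚ) [Wd.IsElliptic] [Wd.IsGloballyMinimal],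
        (∃ C : WeierstrassCurve.VariableChange ℚ, C • W.quadraticTwist (NumberField.discr K : ℚ) = Wd) →
        Wd.analyticRank = 1 → Nat.card (Wd.selmerGroup 2) = 2 → padicValNat 2 Wd.tamagawaProduct ≤ 1 →
      Nat.card (W.selmerGroup 2) = 4 → MultPublishedInputsAtTwo →
      -- (SOC) for Good⁻ classes
      (∀ (M : ℕ), M₀ + 1 ≤ M → ∀ (s₀ : galH1Torsion W ((2 ^ M : ℕ) : ℤ)), s₀ ∈ selmerGroup W ((2 ^ M : ℕ) : ℤ) →
          (∃ c : galH1Torsion W 2, c ≠ 0 ∧ c ∈ W.torsionLocalKer (v.adicCompletion ℚ) 2 ∧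
            ∀ hdvd₁ : (2 : ℤ) ∣ ((2 ^ M : ℕ) : ℤ), torsionH1OfDvd W hdvd₁ c ∈ AddSubgroup.zmultiples s₀) →
          ∀ (hdvd : ((2 ^ M : ℕ) : ℤ) ∣ ((2 ^ (M + 1) : ℕ) : ℤ)), ∃ i j : ℕ,
            ((2 ^ i : ℕ) : ℤ) • torsionH1OfDvd (W.baseChange K) hdvd (resTorsion W K ((2 ^ M : ℕ) : ℤ) s₀) =
              ((2 ^ j : ℕ) : ℤ) • torsionH1OfDvd (W.baseChange K) hdvd (d₁.kolyvaginClass Nat.prime_two M) ∧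
            ((2 ^ j : ℕ) : ℤ) • torsionH1OfDvd (W.baseChange K) hdvd (d₁.kolyvaginClass Nat.prime_two M) ≠ 0 ∧
            (2 : ℤ) • (((2 ^ j : ℕ) : ℤ) • torsionH1OfDvd (W.baseChange K) hdvd (d₁.kolyvaginClass Nat.prime_two M)) = 0) ∧
      -- (LTV)
      (∃ u ∈ W.selmerGroup 2, u ≠ 0 ∧ u ∈ W.torsionLocalKer (v.adicCompletion ℚ) 2) :=
  fun W _ _ _ hr0 hρ hTam hneg K _ _ hIQ hodd h3 hHe hsq1 hsq2 ℓ₀ v hℓ₀ hdK h2K hv hVIS Dt hopt hc β ι d₁ hy M₀ hdiv hndiv Wd _ _ hWd hrd hSel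
      hbudget h4 hGZK ↦
    ⟨sharedSocle_of_doorTrivialSocle W hr0 hρ hTam hneg K hIQ hodd h3 hHe hsq1 hsq2 ℓ₀ v hℓ₀ hdK h2K hv hVIS Dt hopt hc β ι d₁ hy M₀ hdiv hndiv Wd
        hWd hrd hSel hbudget h4 hGZK,
      exists_doorTrivial_ne_zero_of_deepPrimeFrame W hr0 hρ hTam hneg K hIQ hodd h3 hHe hsq1 hsq2 ℓ₀ v hℓ₀ hdK h2K hv hVIS Dt hopt hc β ι d₁ hy M₀
        hdiv hndiv Wd hWd hrd hSel hbudget h4 hGZK⟩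

end SOC

end Summit.BirchSwinnertonDyer.BirchSwinnertonDyer.Theorems.GenusExact.PlusDescent.SocleSelection

end
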